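import Summits.QuantumFields.YangMills.Theorems.ColdStartUniversalityNeutralColdStartMixingValleyMixingFixedCutoff
import HarnessLib

/-!
# Route `ColdStartUniversality`, crux K_A1|Γ `NeutralColdStartMixing` (stmt-QuantumFields-27363), LINE 7
# «valley_averaging»: THE FIXED-CUT-OFF RUNG OF STUB 1 — at every step `K`, `AdiabaticValleyTracking` holds with
# `δ = 0` and a `K`-dependent burn-in constant, for EVERY loop string

Helper file (seat `ym-line-csu-p1`, g14; `--supports stmt-QuantumFields-27363`).  Companion of
`…ValleyMixingFixedCutoff` (the fixed-`K` rung of stub 2).  At FIXED `K` the time integrals `∫₀ᵀ E[g_os(U(s/ε_K))] ds` and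
`∫₀ᵀ E[vproj_K(U(s/ε_K))] ds` (`vproj_K = E_Gibbs[g_os | valley σ-algebra]`) BOTH differ from `T·expectAt K os` by at
most `ε_K C/c` (uniform exponential mixing `exp_mixing_szz`, Gibbs dictionary, `∫ vproj dGibbs = ∫ g dGibbs`; truncation of
`vproj` + `stub_langevinLawAbsCont` to pass from a.e. to everywhere bounds), so their difference is bounded by a constant
`c(K)` for ALL `T` — item 27403 with the quantifiers swapped (`∀ K ∃ c`) and `δ = 0`, and without the evenness restriction
on `os`.  Hence the ENTIRE content of BOTH stubs of LINE 7 is the cut-off UNIFORMITY of their constants.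

* ★ `adiabaticValleyTracking_fixedCutoff`.

THEOREMS ONLY; RECORD-rung R3 plumbing (BC5-type witness); no crux, rung or summit statement is proved here and the
Yang–Mills mass gap is NOT proved.
-/

set_option autoImplicit false

noncomputable section

namespace Summit.QuantumFields.YangMills.Theorems.ColdStartUniversality

open MeasureTheory Filter
open scoped NNReal
open Literature.MathematicalPhysics.QuantumFieldTheory
open Literature.MathematicalPhysics.QuantumLattice (fundamentalRep fundamentalLatticeRep continuous_fundamentalRep)
open Literature.MathematicalPhysics.QuantumFieldTheory.Balaban1983to89

/-- `∫₀ᵀ C e^{−ct} dt ≤ C/c` for `C ≥ 0`, `c > 0` (any real `T`). [folklore] -/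
theorem integral_const_mul_exp_neg_le {C c T : ℝ} (hC : 0 ≤ C) (hc : 0 < c) :
    ∫ t in (0 : ℝ)..T, C * Real.exp (-c * t) ≤ C / c := by
  have h1 : ∫ t in (0 : ℝ)..T, C * Real.exp (-c * t) = C * ((Real.exp (-c * T) - 1) / (-c)) := by
    rw [intervalIntegral.integral_const_mul]
    congr 1
    rw [intervalIntegral.integral_comp_mul_left (fun x => Real.exp x) (neg_ne_zero.2 hc.ne'), integral_exp, mul_zero,
      Real.exp_zero, smul_eq_mul, inv_eq_one_div, one_div_mul_eq_div]
  rw [h1]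
  have h2 : (Real.exp (-c * T) - 1) / (-c) ≤ 1 / c := by
    rw [div_neg, ← neg_div, neg_sub]
    exact div_le_div_of_nonneg_right (by linarith [Real.exp_pos (-c * T)]) hc.le
  calc C * ((Real.exp (-c * T) - 1) / (-c)) ≤ C * (1 / c) := mul_le_mul_of_nonneg_left h2 hC
    _ = C / c := mul_one_div C c

/-- **Cesàro numerator bound from pointwise exponential mixing**: if `G` is interval integrable, `|G t − m| ≤ C e^{−ct}`
for `t > 0`, then `|∫₀^{T'} G − T' m| ≤ C/c`. [folklore] -/
theorem abs_integral_sub_mul_le_of_expMixing {G : ℝ → ℝ} {m C c T' : ℝ} (hC : 0 ≤ C) (hc : 0 < c) (hT' : 0 ≤ T')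
    (hGi : IntervalIntegrable G volume 0 T') (hmix : ∀ t : ℝ, 0 < t → |G t - m| ≤ C * Real.exp (-c * t)) :
    |(∫ t in (0 : ℝ)..T', G t) - T' * m| ≤ C / c := by
  have hsub : (∫ t in (0 : ℝ)..T', G t) - T' * m = ∫ t in (0 : ℝ)..T', (G t - m) := by
    rw [intervalIntegral.integral_sub hGi intervalIntegrable_const, intervalIntegral.integral_const, sub_zero, smul_eq_mul]
  rw [hsub]
  have hb := intervalIntegral.norm_integral_le_of_norm_le (μ := volume) (f := fun t => G t - m)
    (g := fun t => C * Real.exp (-c * t)) hT'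
    (ae_of_all _ fun t ht => by rw [Real.norm_eq_abs]; exact hmix t ht.1)
    ((continuous_const.mul (Real.continuous_exp.comp (continuous_const.mul continuous_id))).intervalIntegrable _ _)
  rw [Real.norm_eq_abs] at hb
  exact hb.trans (integral_const_mul_exp_neg_le hC hc)

/-- ★ **THE FIXED-CUT-OFF RUNG OF `AdiabaticValleyTracking`** (item 27403 with `∀ K ∃ c`, `δ = 0`, every loop string):
at every step `K` there is `c ≥ 0` such that along every cold-start solution and for every `T > 0` the physical-time
integrals of `E[vproj_K(U(s/ε_K))]` and `E[∏_{C∈os} avgObs K C (U(s/ε_K))]` differ by at most `c`.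
[cite: ShenZhuZhu2022, §3 Lemma 3.3] -/
theorem adiabaticValleyTracking_fixedCutoff :
    ∀ (F : Literature.MathematicalPhysics.QuantumFieldTheory.Balaban1983to89.T3ContinuumYM3Torus.T3Family) (γ : ℝ), 0 < γ → ∀ (os : List (Literature.MathematicalPhysics.QuantumFieldTheory.Balaban1983to89.T3ContinuumYM3Torus.ULoop3 F)) (K : ℕ), ∃ c : ℝ, 0 ≤ c ∧ ∀ (Ω : Type) (mΩ : MeasurableSpace Ω) (P : MeasureTheory.Measure Ω) (hP : MeasureTheory.IsProbabilityMeasure P) (W : NNReal → Ω → (Literature.MathematicalPhysics.QuantumFieldTheory.Edge 3 ((F.P K).sitesPerDir 0) × Literature.MathematicalPhysics.QuantumFieldTheory.NoiseIdx 2 → ℝ)) (hW : Literature.MathematicalPhysics.QuantumFieldTheory.IsFlatBrownian W P) (U : NNReal → Ω → Literature.MathematicalPhysics.QuantumFieldTheory.GaugeConfig 3 ((F.P K).sitesPerDir 0) (Matrix.specialUnitaryGroup (Fin 2) ℂ)), (∀ ω, U 0 ω = fun _ => 1) → (Literature.MathematicalPhysics.QuantumFieldTheory.latticeLangevinDynamics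 (⟨2, Literature.MathematicalPhysics.QuantumLattice.fundamentalRep (Fin 2), Literature.MathematicalPhysics.QuantumLattice.continuous_fundamentalRep _, Literature.MathematicalPhysics.QuantumLattice.fundamentalRep_injective _, Literature.MathematicalPhysics.QuantumLattice.fundamentalRep_mem_unitaryGroup⟩ : Literature.MathematicalPhysics.QuantumFieldTheory.LatticeRep (Matrix.specialUnitaryGroup (Fin 2) ℂ)) ((γ * (F.P K).eps)⁻¹ / 2)).IsSolution (Literature.MathematicalPhysics.QuantumLattice.fundamentalRep (Fin 2)) hW.natFiltration P W U → ∀ (T : ℝ), 0 < T → |intervalIntegral (fun s : ℝ => MeasureTheory.integral P (fun ω => (MeasureTheory.condExp (MeasurableSpace.comap (fun (V : Literature.MathematicalPhysics.QuantumFieldTheory.Balaban1983to89.GaugeField (F.P K) 0 (Matrix.specialUnitaryGroup (Fin 2) ℂ)) (μ : Fin 3) => (Fintype.card F.USite : ℝ)⁻¹ * ∑ x : F.USite, F.avgObs (Literature.MathematicalPhysics.QuantumFieldTheory.Balaban1983to89.ExpMeanLog.expMeanLogSU : Literature.MathematicalPhysics.QuantumFieldTheory.Balaban1983to89.LoopAverage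 (Matrix.specialUnitaryGroup (Fin 2) ℂ)) K (Literature.MathematicalPhysics.QuantumFieldTheory.Balaban1983to89.T3ContinuumYM3Torus.ULoop3.polyakov μ x) V) MeasurableSpace.pi) (Literature.MathematicalPhysics.QuantumFieldTheory.Balaban1983to89.T4GenFunBounds.gibbsMeasure (G := Matrix.specialUnitaryGroup (Fin 2) ℂ) (F.P K) ((F.scheme (Literature.MathematicalPhysics.QuantumFieldTheory.Balaban1983to89.ExpMeanLog.expMeanLogSU : Literature.MathematicalPhysics.QuantumFieldTheory.Balaban1983to89.LoopAverage (Matrix.specialUnitaryGroup (Fin 2) ℂ)) γ).β K)) (fun V : Literature.MathematicalPhysics.QuantumFieldTheory.Balaban1983to89.GaugeField (F.P K) 0 (Matrix.specialUnitaryGroup (Fin 2) ℂ) => (os.map fun C => F.avgObs (Literature.MathematicalPhysics.QuantumFieldTheory.Balaban1983to89.ExpMeanLog.expMeanLogSU : Literature.MathematicalPhysics.QuantumFieldTheory.Balaban1983to89.LoopAverage (Matrix.specialUnitaryGroup (Fin 2) ℂ)) K C V).prod)) (fun b : Literature.MathematicalPhysics.QuantumFieldTheory.Balaban1983to89.PBond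 (F.P K) 0 => U (s / (F.P K).eps).toNNReal ω (b.src, b.dir)))) 0 T MeasureTheory.volume - intervalIntegral (fun s : ℝ => MeasureTheory.integral P (fun ω => (os.map fun C => F.avgObs (Literature.MathematicalPhysics.QuantumFieldTheory.Balaban1983to89.ExpMeanLog.expMeanLogSU : Literature.MathematicalPhysics.QuantumFieldTheory.Balaban1983to89.LoopAverage (Matrix.specialUnitaryGroup (Fin 2) ℂ)) K C (fun b : Literature.MathematicalPhysics.QuantumFieldTheory.Balaban1983to89.PBond (F.P K) 0 => U (s / (F.P K).eps).toNNReal ω (b.src, b.dir))).prod)) 0 T MeasureTheory.volume| ≤ c := by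
  intro F γ hγ os K
  classical
  -- notation
  set ε : ℝ := (F.P K).eps with hεdef
  have hε : 0 < ε := (F.P K).eps_pos
  set β' : ℝ := (γ * ε)⁻¹ / 2 with hβ'
  set ℰ : LoopAverage (Matrix.specialUnitaryGroup (Fin 2) ℂ) := ExpMeanLog.expMeanLogSU with hℰ
  have hβK : 0 ≤ (F.scheme ℰ γ).β K := F.scheme_β_nonneg _ hγ.le K
  set μG := T4GenFunBounds.gibbsMeasure (G := Matrix.specialUnitaryGroup (Fin 2) ℂ) (F.P K) ((F.scheme ℰ γ).β K) with hμG
  haveI : IsProbabilityMeasure μG :=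
    T4GenFunBounds.isProbabilityMeasure_gibbsMeasure (G := Matrix.specialUnitaryGroup (Fin 2) ℂ) (F.P K) hβK
  set μW : Measure (GaugeConfig 3 ((F.P K).sitesPerDir 0) (Matrix.specialUnitaryGroup (Fin 2) ℂ)) :=
    wilsonMeasure (d := 3) (L := (F.P K).sitesPerDir 0) (fundamentalRep (Fin 2)) β' with hμW
  set dict : GaugeConfig 3 ((F.P K).sitesPerDir 0) (Matrix.specialUnitaryGroup (Fin 2) ℂ) →
      GaugeField (F.P K) 0 (Matrix.specialUnitaryGroup (Fin 2) ℂ) := fun V => fun b : PBond (F.P K) 0 => V (b.src, b.dir)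
    with hdict
  have hΦ : Measurable dict := measurable_pi_lambda _ fun b => measurable_pi_apply _
  have hG : μG = μW.map dict := gibbsMeasure_eq_map_wilsonMeasure (F.P K) hβK
  -- the string, the valley coordinate, the valley projection
  set θ : GaugeField (F.P K) 0 (Matrix.specialUnitaryGroup (Fin 2) ℂ) → (Fin 3 → ℝ) := fun V μ =>
    (Fintype.card F.USite : ℝ)⁻¹ * ∑ x : F.USite, F.avgObs ℰ K (T3ContinuumYM3Torus.ULoop3.polyakov μ x) V with hθ
  set gstr : GaugeField (F.P K) 0 (Matrix.specialUnitaryGroup (Fin 2) ℂ) → ℝ := fun V =>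
    (os.map fun C => F.avgObs ℰ K C V).prod with hgstr
  set vproj : GaugeField (F.P K) 0 (Matrix.specialUnitaryGroup (Fin 2) ℂ) → ℝ :=
    MeasureTheory.condExp (MeasurableSpace.comap θ MeasurableSpace.pi) μG gstr with hvproj
  have hAvg : F.AvgMeasurable ℰ := F.avgMeasurable_of_measurableE ℰ T4ApexTwoLevel.measurableE_expMeanLogSU
  have hθm : Measurable θ := by
    refine measurable_pi_lambda _ fun μ => ?_
    exact (Finset.measurable_sum _ fun x _ => F.measurable_avgObs hAvg K _).const_mul _
  have hm : MeasurableSpace.comap θ MeasurableSpace.pi ≤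
      (inferInstance : MeasurableSpace (GaugeField (F.P K) 0 (Matrix.specialUnitaryGroup (Fin 2) ℂ))) := hθm.comap_le
  have hgm : Measurable gstr :=
    T4GenFunBounds.measurable_prodObs (F.scheme ℰ γ) (fun K' C => F.measurable_avgObs hAvg K' C) K os
  have hgb : ∀ V, |gstr V| ≤ 1 := fun V =>
    abs_prod_map_le_one' (fun C => F.avgObs ℰ K C V) (fun C => F.abs_avgObs_le_one ℰ K C V) os
  have hvm : Measurable vproj := (stronglyMeasurable_condExp.mono hm).measurable
  have hvbd : ∀ᵐ V ∂μG, |vproj V| ≤ 1 :=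
    ae_bdd_abs_condExp_of_ae_bdd_abs (m := MeasurableSpace.comap θ MeasurableSpace.pi) (μ := μG) (R := (1 : ℝ))
      (f := gstr) (Filter.Eventually.of_forall hgb)
  -- truncation of `vproj`
  set v' : GaugeField (F.P K) 0 (Matrix.specialUnitaryGroup (Fin 2) ℂ) → ℝ := fun V => max (-1) (min 1 (vproj V)) with hv'
  have hv'm : Measurable v' := measurable_const.max (measurable_const.min hvm)
  have hv'b : ∀ V, |v' V| ≤ 1 := fun V => by
    rw [abs_le]
    exact ⟨le_max_left _ _, max_le (by norm_num) (min_le_left _ _)⟩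
  have hv'ae : v' =ᵐ[μG] vproj := by
    filter_upwards [hvbd] with V hV
    rw [abs_le] at hV
    show max (-1) (min 1 (vproj V)) = vproj V
    rw [min_eq_right hV.2, max_eq_right hV.1]
  -- the common Gibbs mean `m`
  set m : ℝ := ∫ V, gstr V ∂μG with hmdef
  have hmv : ∫ V, v' V ∂μG = m := by
    rw [integral_congr_ae hv'ae, hvproj, integral_condExp hm]
  -- exponential mixing at fixed `K`
  obtain ⟨C, c, hC, hc, hmix⟩ := exp_mixing_szz ((F.P K).sitesPerDir 0) β'
  refine ⟨ε * (C / c) + ε * (C / c), by positivity, fun Ω mΩ P hP W hW U hU0 hsol T hT => ?_⟩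
  -- the two lattice-time integrands
  set f₁ : GaugeConfig 3 ((F.P K).sitesPerDir 0) (Matrix.specialUnitaryGroup (Fin 2) ℂ) → ℝ := fun V => gstr (dict V) with hf₁
  set f₂ : GaugeConfig 3 ((F.P K).sitesPerDir 0) (Matrix.specialUnitaryGroup (Fin 2) ℂ) → ℝ := fun V => v' (dict V) with hf₂
  have hf₁m : Measurable f₁ := hgm.comp hΦ
  have hf₂m : Measurable f₂ := hv'm.comp hΦ
  have hf₁b : ∀ V, |f₁ V| ≤ 1 := fun V => hgb _
  have hf₂b : ∀ V, |f₂ V| ≤ 1 := fun V => hv'b _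
  obtain ⟨-, hG₁i⟩ := integrand_bound_and_intervalIntegrable hW hsol hf₁m hf₁b
  obtain ⟨-, hG₂i⟩ := integrand_bound_and_intervalIntegrable hW hsol hf₂m hf₂b
  -- Wilson means = Gibbs means = `m`
  have hm₁ : ∫ y, f₁ y ∂μW = m := by
    rw [hmdef, hG, integral_map hΦ.aemeasurable hgm.aestronglyMeasurable]
  have hm₂ : ∫ y, f₂ y ∂μW = m := by
    rw [← hmv, hG, integral_map hΦ.aemeasurable hv'm.aestronglyMeasurable]
  -- pointwise exponential mixing in lattice time, for `t > 0`
  have hpt : ∀ (f : GaugeConfig 3 ((F.P K).sitesPerDir 0) (Matrix.specialUnitaryGroup (Fin 2) ℂ) → ℝ),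
      Measurable f → (∀ V, |f V| ≤ 1) → ∫ y, f y ∂μW = m →
      ∀ t : ℝ, 0 < t → |(∫ ω, f (U t.toNNReal ω) ∂P) - m| ≤ C * Real.exp (-c * t) := by
    intro f hfm hfb hfmean t ht
    have h := hmix (fun _ => 1) t.toNNReal f hfm hfb Ω P W hW U hU0 hsol
    rw [hfmean, Real.coe_toNNReal t ht.le] at h
    exact h
  have hT' : 0 ≤ T / ε := (div_pos hT hε).le
  have hb₁ := abs_integral_sub_mul_le_of_expMixing hC.le hc hT' (hG₁i (T / ε)) (hpt f₁ hf₁m hf₁b hm₁)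
  have hb₂ := abs_integral_sub_mul_le_of_expMixing hC.le hc hT' (hG₂i (T / ε)) (hpt f₂ hf₂m hf₂b hm₂)
  -- change of variables `s = ε t` in both physical-time integrals
  have hcv : ∀ (G : ℝ → ℝ), ∫ s in (0 : ℝ)..T, G (s / ε) = ε * ∫ t in (0 : ℝ)..(T / ε), G t := by
    intro G
    rw [intervalIntegral.integral_comp_div G hε.ne', zero_div, smul_eq_mul]
  -- along the flow `v' = vproj` for positive times
  have hflow : ∀ s : ℝ, 0 < s →
      ∫ ω, f₂ (U (s / ε).toNNReal ω) ∂P = ∫ ω, vproj (fun b : PBond (F.P K) 0 => U (s / (F.P K).eps).toNNReal ω (b.src, b.dir)) ∂P := by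
    intro s hs
    have hspos : 0 < (s / (F.P K).eps).toNNReal := Real.toNNReal_pos.2 (div_pos hs hε)
    have hac := stub_langevinLawAbsCont F γ hγ K Ω mΩ P hP W hW U hU0 hsol _ hspos
    have hac' : P.map (fun ω => fun b : PBond (F.P K) 0 => U (s / (F.P K).eps).toNNReal ω (b.src, b.dir)) ≪ μG :=
      hac.trans (fieldMeasure_absolutelyContinuous_gibbsMeasure (F.P K) ((F.scheme ℰ γ).β K))
    have hUm : Measurable (U (s / (F.P K).eps).toNNReal) := (hsol.adapted _).mono (hW.natFiltration.le _) le_rfl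
    have hΨ : Measurable fun ω => (fun b : PBond (F.P K) 0 => U (s / (F.P K).eps).toNNReal ω (b.src, b.dir) :
        GaugeField (F.P K) 0 (Matrix.specialUnitaryGroup (Fin 2) ℂ)) := hΦ.comp hUm
    exact integral_congr_ae (ae_eq_comp' hΨ.aemeasurable hv'ae hac')
  have hI₂ : ∫ s in (0 : ℝ)..T, ∫ ω, vproj (fun b : PBond (F.P K) 0 => U (s / (F.P K).eps).toNNReal ω (b.src, b.dir)) ∂P =
      ε * ∫ t in (0 : ℝ)..(T / ε), ∫ ω, f₂ (U t.toNNReal ω) ∂P := by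
    rw [← hcv (fun t => ∫ ω, f₂ (U t.toNNReal ω) ∂P)]
    refine intervalIntegral.integral_congr_ae (ae_of_all _ fun s hs => ?_)
    rw [Set.uIoc_of_le hT.le] at hs
    exact (hflow s hs.1).symm
  have hI₁ : ∫ s in (0 : ℝ)..T, ∫ ω, gstr (fun b : PBond (F.P K) 0 => U (s / (F.P K).eps).toNNReal ω (b.src, b.dir)) ∂P =
      ε * ∫ t in (0 : ℝ)..(T / ε), ∫ ω, f₁ (U t.toNNReal ω) ∂P := by
    rw [← hcv (fun t => ∫ ω, f₁ (U t.toNNReal ω) ∂P)]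
  show |(∫ s in (0 : ℝ)..T, ∫ ω, vproj (fun b : PBond (F.P K) 0 => U (s / (F.P K).eps).toNNReal ω (b.src, b.dir)) ∂P) -
      ∫ s in (0 : ℝ)..T, ∫ ω, gstr (fun b : PBond (F.P K) 0 => U (s / (F.P K).eps).toNNReal ω (b.src, b.dir)) ∂P| ≤
    ε * (C / c) + ε * (C / c)
  rw [hI₁, hI₂, ← mul_sub, abs_mul, abs_of_pos hε]
  have hkey : |(∫ t in (0 : ℝ)..(T / ε), ∫ ω, f₂ (U t.toNNReal ω) ∂P) - ∫ t in (0 : ℝ)..(T / ε), ∫ ω, f₁ (U t.toNNReal ω) ∂P|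
      ≤ C / c + C / c := by
    calc |(∫ t in (0 : ℝ)..(T / ε), ∫ ω, f₂ (U t.toNNReal ω) ∂P) - ∫ t in (0 : ℝ)..(T / ε), ∫ ω, f₁ (U t.toNNReal ω) ∂P|
        = |((∫ t in (0 : ℝ)..(T / ε), ∫ ω, f₂ (U t.toNNReal ω) ∂P) - T / ε * m) -
            ((∫ t in (0 : ℝ)..(T / ε), ∫ ω, f₁ (U t.toNNReal ω) ∂P) - T / ε * m)| := by ring_nf
      _ ≤ |(∫ t in (0 : ℝ)..(T / ε), ∫ ω, f₂ (U t.toNNReal ω) ∂P) - T / ε * m| +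
            |(∫ t in (0 : ℝ)..(T / ε), ∫ ω, f₁ (U t.toNNReal ω) ∂P) - T / ε * m| := abs_sub _ _
      _ ≤ C / c + C / c := add_le_add hb₂ hb₁
  calc ε * |(∫ t in (0 : ℝ)..(T / ε), ∫ ω, f₂ (U t.toNNReal ω) ∂P) - ∫ t in (0 : ℝ)..(T / ε), ∫ ω, f₁ (U t.toNNReal ω) ∂P|
      ≤ ε * (C / c + C / c) := mul_le_mul_of_nonneg_left hkey hε.le
    _ = ε * (C / c) + ε * (C / c) := mul_add _ _ _

end Summit.QuantumFields.YangMills.Theorems.ColdStartUniversality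

end
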